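import Summits.KontsevichZagierPeriods.KontsevichZagierPeriods.Theorems.HurwitzMicroSectorsNormalFormPrincipleLevelOne
import Summits.KontsevichZagierPeriods.KontsevichZagierPeriods.Theorems.HurwitzMicroSectorsNormalFormPrincipleSlabASubPtK20
import Summits.KontsevichZagierPeriods.KontsevichZagierPeriods.Theorems.HurwitzMicroSectorsNormalFormPrincipleAlgCarriers
import Summits.KontsevichZagierPeriods.KontsevichZagierPeriods.Theorems.HurwitzMicroSectorsNormalFormPrincipleM2FiveZetaTwo

/-!
# `NormalFormPrinciple` (stmt-KontsevichZagierPeriods-3869), line `SketchIdeator1` — leaf `stub_boxRigidity`: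
# weight two, level `K`, off the diagonal: the representations of the level-`K` pipeline exist

Registered sub-goal `levelK_exists_reps` of the layer `LevelK` (weight two, level `K ≥ 1`, off the
diagonal: the boxes `[(0,1)², c·x₀^a x₁^b/(1 − x₀^K x₁^K)]`). For a real algebraic coefficient `c`
(`IsAlgebraic ℚ c`) the three shapes of honest Kontsevich–Zagier integral representations met
along the level-`K` pipeline exist, with LITERAL domains and integrands:

* the level-`K` monomial box `[(0,1)², c·x₀^a x₁^b/(1 − x₀^K x₁^K)]`: `ℚ`-semialgebraic as the
  product of the algebraic constant `c` (`isSemialgebraicFunOn_const_of_isAlgebraic`) and a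
  quotient of `ℚ`-polynomials (`1 − x₀^K x₁^K > 0` on the box); absolutely convergent by
  DOMINATION from level one: on the box `0 < 1 − x₀x₁ ≤ 1 − x₀^K x₁^K` (`(x₀x₁)^K ≤ x₀x₁` as
  `0 ≤ x₀x₁ ≤ 1` and `K ≥ 1`), so `|c·x₀^a x₁^b/(1 − x₀^K x₁^K)| ≤ |c·x₀^a x₁^b/(1 − x₀x₁)|`, and
  the right-hand side is integrable by Beukers' integral for `ζ(2)` (seat c7's
  `LevelOne.integrableOn_aeval_div_one_sub_mul`, the real constant factored out);
* the triangle `[{0 < z₀ < 1, 0 ≤ z₁ ≤ z₀}, c·z₀^{a−b−1} z₁^b/(1 − z₁^K)]` — the image of the box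
  monomial under the merge gadget `(x₀, x₁) ↦ (x₀, x₀x₁)` (rule 2) — again dominated by the
  level-one triangle integrand (`0 < 1 − z₁ ≤ 1 − z₁^K` on the triangle,
  `LevelOne.integrableOn_triangleIntegrand`);
* the dimension-one box `[(0,1), (c/(a−b))·(u^b − u^a)/(1 − u^K)]` for ALL `a b` (truncated
  subtraction of `ℕ` and `c/0 = 0`, so the integrand is `0` unless `b < a`) — the result of
  integrating out `z₀` (rule 3): the algebraic constant `c/(a−b)` times a quotient of
  `ℚ`-polynomials whose denominator `1 − u^K` is positive on `(0,1)`; absolutely convergent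
  because it is BOUNDED on `(0,1)`: by Bernoulli's inequality `1 − u^n ≤ n(1 − u)` and
  `u^K ≤ u`, `|u^b − u^a| ≤ (1 − u^a) + (1 − u^b) ≤ (a + b)(1 − u) ≤ (a + b)(1 − u^K)`, whence
  `|integrand| ≤ |c/(a−b)|·(a + b)` — a bounded measurable function on a set of finite measure.

References: M. Kontsevich, D. Zagier, *Periods* (2001), §1.1–1.2; F. Beukers, *A note on the
irrationality of ζ(2) and ζ(3)*, Bull. LMS 11 (1979). No new definitions.
-/

noncomputable section

open MeasureTheory Set
open Literature.NumberTheory.Transcendental Literature.NumberTheory.Transcendental.KZ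
open Literature.ModelTheory.ExponentialFields (IsSemialgebraic)

namespace Summit.KontsevichZagierPeriods.HurwitzMicroSectors.NormalFormPrinciple.PiBox.LevelK

/-! ## The level-`K` monomial box -/

/-- On the open unit box of `ℝ²` the level-`K` denominator (`K ≥ 1`) dominates the level-one
denominator: `0 < 1 − x₀x₁ ≤ 1 − x₀^K x₁^K` (since `0 ≤ x₀x₁ < 1` gives `(x₀x₁)^K ≤ x₀x₁`).
[folklore] -/
theorem lk_box_denominator_bounds {K : ℕ} (hK : 0 < K) {x : Fin 2 → ℝ}
    (hx : ∀ i, x i ∈ Set.Ioo (0:ℝ) 1) :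
    0 < 1 - x 0 * x 1 ∧ 1 - x 0 * x 1 ≤ 1 - x 0 ^ K * x 1 ^ K := by
  have h0 := hx 0
  have h1 := hx 1
  have hp : 0 ≤ x 0 * x 1 := mul_nonneg h0.1.le h1.1.le
  have hlt : x 0 * x 1 < 1 := mul_lt_one_of_nonneg_of_lt_one_left h0.1.le h0.2 h1.2.le
  have hpow : (x 0 * x 1) ^ K ≤ x 0 * x 1 := pow_le_of_le_one hp hlt.le hK.ne'
  rw [mul_pow] at hpow
  exact ⟨sub_pos.2 hlt, by linarith⟩

/-- **Semialgebraicity of the level-`K` monomial integrand with an algebraic coefficient.**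
`x ↦ c·x₀^a x₁^b/(1 − x₀^K x₁^K)` (`K ≥ 1`) is `ℚ`-semialgebraic on the open unit box for real
algebraic `c`: the constant `c` is `ℚ`-semialgebraic (`isSemialgebraicFunOn_const_of_isAlgebraic`)
and so is the quotient of `ℚ`-polynomials `x₀^a x₁^b/(1 − x₀^K x₁^K)`, whose denominator is
positive on the box. [cite: KontsevichZagier2001, §1.1] -/
theorem lk_isSemialgebraicFunOn_boxIntegrand {K : ℕ} (hK : 0 < K) (a b : ℕ) {c : ℝ}
    (hc : IsAlgebraic ℚ c) :
    IsSemialgebraicFunOn ℚ {x : Fin 2 → ℝ | ∀ i, x i ∈ Set.Ioo (0:ℝ) 1}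
      (fun x => c * (x 0 ^ a * x 1 ^ b) / (1 - x 0 ^ K * x 1 ^ K)) := by
  refine (IsSemialgebraicFunOn.mul_holds
    (isSemialgebraicFunOn_const_of_isAlgebraic (isSemialgebraic_box 2) hc)
    (isSemialgebraicFunOn_aeval_div_aeval (isSemialgebraic_box 2)
      (MvPolynomial.X 0 ^ a * MvPolynomial.X 1 ^ b)
      (1 - MvPolynomial.X 0 ^ K * MvPolynomial.X 1 ^ K) fun x hx => ?_)).congr fun x _ => ?_
  · have h := lk_box_denominator_bounds hK hx
    simp only [map_sub, map_one, map_mul, map_pow, MvPolynomial.aeval_X]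
    exact (h.1.trans_le h.2).ne'
  · simp only [Pi.mul_apply, map_sub, map_one, map_mul, map_pow, MvPolynomial.aeval_X]
    ring

/-- **Absolute convergence of the level-`K` monomial integrand with a real coefficient**
(`K ≥ 1`): `c·x₀^a x₁^b/(1 − x₀^K x₁^K)` is integrable on the open unit box — it is measurable and
dominated in absolute value by the level-one integrand `c·x₀^a x₁^b/(1 − x₀x₁)`
(`0 < 1 − x₀x₁ ≤ 1 − x₀^K x₁^K`), which is integrable by Beukers' double integral for `ζ(2)`
(seat c7's `LevelOne.integrableOn_aeval_div_one_sub_mul`, the constant factored out).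
[cite: KontsevichZagier2001, §1.1] -/
theorem lk_integrableOn_boxIntegrand {K : ℕ} (hK : 0 < K) (a b : ℕ) (c : ℝ) :
    IntegrableOn (fun x : Fin 2 → ℝ => c * (x 0 ^ a * x 1 ^ b) / (1 - x 0 ^ K * x 1 ^ K))
      {x | ∀ i, x i ∈ Set.Ioo (0:ℝ) 1} := by
  have hA : MeasurableSet {x : Fin 2 → ℝ | ∀ i, x i ∈ Set.Ioo (0:ℝ) 1} :=
    IsSemialgebraic.measurableSet_holds (isSemialgebraic_box 2)
  have h1 : IntegrableOn (fun x : Fin 2 → ℝ => c * (x 0 ^ a * x 1 ^ b) / (1 - x 0 * x 1))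
      {x | ∀ i, x i ∈ Set.Ioo (0:ℝ) 1} := by
    have h := (LevelOne.integrableOn_aeval_div_one_sub_mul
      (MvPolynomial.X 0 ^ a * MvPolynomial.X 1 ^ b)).const_mul c
    have e : (fun x : Fin 2 → ℝ => c * (x 0 ^ a * x 1 ^ b) / (1 - x 0 * x 1)) =
        fun x : Fin 2 → ℝ => c * ((MvPolynomial.aeval x
          (MvPolynomial.X 0 ^ a * MvPolynomial.X 1 ^ b : MvPolynomial (Fin 2) ℚ) : ℝ) /
            (1 - x 0 * x 1)) := by
      funext x
      simp only [map_mul, map_pow, MvPolynomial.aeval_X]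
      ring
    rw [e]
    exact h
  refine Integrable.mono h1 (Measurable.aestronglyMeasurable (by fun_prop))
    (ae_restrict_of_forall_mem hA fun x hx => ?_)
  have hb := lk_box_denominator_bounds hK hx
  rw [Real.norm_eq_abs, Real.norm_eq_abs, abs_div, abs_div, abs_of_pos hb.1,
    abs_of_pos (hb.1.trans_le hb.2)]
  exact div_le_div_of_nonneg_left (abs_nonneg _) hb.1 hb.2

/-- **The level-`K` monomial box with an algebraic coefficient exists** (`K ≥ 1`):
`[(0,1)², c·x₀^a x₁^b/(1 − x₀^K x₁^K)]` is an integral representation for real algebraic `c`.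
[cite: KontsevichZagier2001, §1.1] -/
theorem lk_exists_boxRep {K : ℕ} (hK : 0 < K) (a b : ℕ) {c : ℝ} (hc : IsAlgebraic ℚ c) :
    ∃ N : IntegralRep 2, N.domain = {x | ∀ i, x i ∈ Set.Ioo (0:ℝ) 1} ∧
      N.integrand = fun x => c * (x 0 ^ a * x 1 ^ b) / (1 - x 0 ^ K * x 1 ^ K) :=
  ⟨⟨_, _, isSemialgebraic_box 2, lk_isSemialgebraicFunOn_boxIntegrand hK a b hc,
    lk_integrableOn_boxIntegrand hK a b c⟩, rfl, rfl⟩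

/-! ## The triangle -/

/-- On the triangle `T = {0 < z₀ < 1, 0 ≤ z₁ ≤ z₀}` the level-`K` denominator (`K ≥ 1`) dominates
the level-one denominator: `0 < 1 − z₁ ≤ 1 − z₁^K` (since `0 ≤ z₁ < 1` gives `z₁^K ≤ z₁`).
[folklore] -/
theorem lk_triangle_denominator_bounds {K : ℕ} (hK : 0 < K) {z : Fin 2 → ℝ}
    (hz : z ∈ KZlog.band {y : Fin 1 → ℝ | 0 < y 0 ∧ y 0 < 1} (fun _ => (0:ℝ)) (fun y => y 0)) :
    0 < 1 - z 1 ∧ 1 - z 1 ≤ 1 - z 1 ^ K := by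
  have h : (0 < z 0 ∧ z 0 < 1) ∧ 0 ≤ z 1 ∧ z 1 ≤ z 0 := hz
  have h1 : z 1 < 1 := h.2.2.trans_lt h.1.2
  have hp : z 1 ^ K ≤ z 1 := pow_le_of_le_one h.2.1 h1.le hK.ne'
  exact ⟨sub_pos.2 h1, by linarith⟩

/-- **Semialgebraicity of the level-`K` triangle integrand with an algebraic coefficient.**
`z ↦ c·z₀^{a−b−1} z₁^b/(1 − z₁^K)` (`K ≥ 1`) is `ℚ`-semialgebraic on the triangle
`{0 < z₀ < 1, 0 ≤ z₁ ≤ z₀}` for real algebraic `c`: the algebraic constant times a quotient of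
`ℚ`-polynomials whose denominator `1 − z₁^K ≥ 1 − z₁ ≥ 1 − z₀ > 0` does not vanish there.
[cite: KontsevichZagier2001, §1.1] -/
theorem lk_isSemialgebraicFunOn_triangleIntegrand {K : ℕ} (hK : 0 < K) (a b : ℕ) {c : ℝ}
    (hc : IsAlgebraic ℚ c) :
    IsSemialgebraicFunOn ℚ
      (KZlog.band {y : Fin 1 → ℝ | 0 < y 0 ∧ y 0 < 1} (fun _ => (0:ℝ)) (fun y => y 0))
      (fun z => c * (z 0 ^ (a - b - 1) * z 1 ^ b) / (1 - z 1 ^ K)) := by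
  refine (IsSemialgebraicFunOn.mul_holds
    (isSemialgebraicFunOn_const_of_isAlgebraic LevelOne.isSemialgebraic_triangleBand hc)
    (isSemialgebraicFunOn_aeval_div_aeval LevelOne.isSemialgebraic_triangleBand
      (MvPolynomial.X 0 ^ (a - b - 1) * MvPolynomial.X 1 ^ b) (1 - MvPolynomial.X 1 ^ K)
      fun z hz => ?_)).congr fun z _ => ?_
  · have h := lk_triangle_denominator_bounds hK hz
    simp only [map_sub, map_one, map_pow, MvPolynomial.aeval_X]
    exact (h.1.trans_le h.2).ne'
  · simp only [Pi.mul_apply, map_sub, map_one, map_mul, map_pow, MvPolynomial.aeval_X]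
    ring

/-- **Absolute convergence of the level-`K` triangle integrand with a real coefficient**
(`K ≥ 1`): `c·z₀^{a−b−1} z₁^b/(1 − z₁^K)` is integrable on the triangle, by domination from level
one: on `T`, `|c·z₀^{a−b−1} z₁^b/(1 − z₁^K)| ≤ |c·z₀^{a−b−1} z₁^b/(1 − z₁)|`, and the right-hand
side is integrable (seat c7's `LevelOne.integrableOn_triangleIntegrand`, Beukers' integral
transported through the merge chart `(x₀, x₁) ↦ (x₀, x₀x₁)`, the constant factored out).
[cite: KontsevichZagier2001, §1.2 rule (2)] -/
theorem lk_integrableOn_triangleIntegrand {K : ℕ} (hK : 0 < K) (a b : ℕ) (c : ℝ) :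
    IntegrableOn (fun z : Fin 2 → ℝ => c * (z 0 ^ (a - b - 1) * z 1 ^ b) / (1 - z 1 ^ K))
      (KZlog.band {y : Fin 1 → ℝ | 0 < y 0 ∧ y 0 < 1} (fun _ => (0:ℝ)) (fun y => y 0)) := by
  have hTm : MeasurableSet
      (KZlog.band {y : Fin 1 → ℝ | 0 < y 0 ∧ y 0 < 1} (fun _ => (0:ℝ)) (fun y => y 0)) :=
    IsSemialgebraic.measurableSet_holds LevelOne.isSemialgebraic_triangleBand
  have h1 : IntegrableOn (fun z : Fin 2 → ℝ => c * (z 0 ^ (a - b - 1) * z 1 ^ b) / (1 - z 1))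
      (KZlog.band {y : Fin 1 → ℝ | 0 < y 0 ∧ y 0 < 1} (fun _ => (0:ℝ)) (fun y => y 0)) := by
    have h := (LevelOne.integrableOn_triangleIntegrand a b 1).const_mul c
    have e : (fun z : Fin 2 → ℝ => c * (z 0 ^ (a - b - 1) * z 1 ^ b) / (1 - z 1)) =
        fun z : Fin 2 → ℝ => c * (((1 : ℚ) : ℝ) * (z 0 ^ (a - b - 1) * z 1 ^ b) / (1 - z 1)) := by
      funext z
      rw [Rat.cast_one, one_mul, mul_div_assoc]
    rw [e]
    exact h
  refine Integrable.mono h1 (Measurable.aestronglyMeasurable (by fun_prop))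
    (ae_restrict_of_forall_mem hTm fun z hz => ?_)
  have h := lk_triangle_denominator_bounds hK hz
  rw [Real.norm_eq_abs, Real.norm_eq_abs, abs_div, abs_div, abs_of_pos h.1,
    abs_of_pos (h.1.trans_le h.2)]
  exact div_le_div_of_nonneg_left (abs_nonneg _) h.1 h.2

/-- **The level-`K` triangle representation with an algebraic coefficient exists** (`K ≥ 1`):
`[{0 < z₀ < 1, 0 ≤ z₁ ≤ z₀}, c·z₀^{a−b−1} z₁^b/(1 − z₁^K)]` is an integral representation for real
algebraic `c` — the image of the box monomial `c·x₀^a x₁^b/(1 − x₀^K x₁^K)` (`a > b`) under the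
merge gadget `u = x₀x₁`. [cite: KontsevichZagier2001, §1.2 rule (2)] -/
theorem lk_exists_triangleRep {K : ℕ} (hK : 0 < K) (a b : ℕ) {c : ℝ} (hc : IsAlgebraic ℚ c) :
    ∃ R : IntegralRep 2,
      R.domain = KZlog.band {y : Fin 1 → ℝ | 0 < y 0 ∧ y 0 < 1} (fun _ => (0:ℝ)) (fun y => y 0) ∧
      R.integrand = fun z => c * (z 0 ^ (a - b - 1) * z 1 ^ b) / (1 - z 1 ^ K) :=
  ⟨⟨_, _, LevelOne.isSemialgebraic_triangleBand,
    lk_isSemialgebraicFunOn_triangleIntegrand hK a b hc,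
    lk_integrableOn_triangleIntegrand hK a b c⟩, rfl, rfl⟩

/-! ## The dimension-one box -/

/-- On `[0,1)` the level-`K` denominator `1 − u^K` (`K ≥ 1`) is positive and controls the
numerator of the dimension-one integrand: `|u^b − u^a| ≤ (a + b)(1 − u^K)`, from
`|u^b − u^a| ≤ (1 − u^a) + (1 − u^b)`, Bernoulli's inequality `1 − u^n ≤ n(1 − u)` and
`1 − u ≤ 1 − u^K` (`u^K ≤ u`). [folklore] -/
theorem lk_dimOne_bounds {K : ℕ} (hK : 0 < K) (a b : ℕ) {u : ℝ} (h0 : 0 ≤ u) (h1 : u < 1) :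
    0 < 1 - u ^ K ∧ |u ^ b - u ^ a| ≤ ((a + b : ℕ) : ℝ) * (1 - u ^ K) := by
  have hKu : u ^ K ≤ u := pow_le_of_le_one h0 h1.le hK.ne'
  have hK1 : u ^ K ≤ 1 := pow_le_one₀ h0 h1.le
  have ha : 1 + (a : ℝ) * (u - 1) ≤ u ^ a := one_add_mul_sub_le_pow (by linarith) a
  have hb : 1 + (b : ℝ) * (u - 1) ≤ u ^ b := one_add_mul_sub_le_pow (by linarith) b
  have ha1 : u ^ a ≤ 1 := pow_le_one₀ h0 h1.le
  have hb1 : u ^ b ≤ 1 := pow_le_one₀ h0 h1.le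
  have p1 : (a : ℝ) * u ^ K ≤ (a : ℝ) * u := mul_le_mul_of_nonneg_left hKu (Nat.cast_nonneg a)
  have p2 : (b : ℝ) * u ^ K ≤ (b : ℝ) * u := mul_le_mul_of_nonneg_left hKu (Nat.cast_nonneg b)
  have p3 : 0 ≤ (a : ℝ) * (1 - u ^ K) := mul_nonneg (Nat.cast_nonneg a) (sub_nonneg.2 hK1)
  have p4 : 0 ≤ (b : ℝ) * (1 - u ^ K) := mul_nonneg (Nat.cast_nonneg b) (sub_nonneg.2 hK1)
  refine ⟨sub_pos.2 (pow_lt_one₀ h0 h1 hK.ne'), abs_le.2 ⟨?_, ?_⟩⟩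
  · push_cast
    linarith
  · push_cast
    linarith

/-- **Semialgebraicity of the dimension-one integrand with an algebraic coefficient.**
`u ↦ (c/(a−b))·(u^b − u^a)/(1 − u^K)` (`K ≥ 1`, truncated subtraction, `c/0 = 0`) is
`ℚ`-semialgebraic on `(0,1)` for real algebraic `c`: the algebraic constant `c/(a−b)`
(`isSemialgebraicFunOn_const_of_isAlgebraic`) times the quotient of `ℚ`-polynomials
`(u^b − u^a)/(1 − u^K)`, whose denominator is positive on `(0,1)`.
[cite: KontsevichZagier2001, §1.1] -/
theorem lk_isSemialgebraicFunOn_dimOneIntegrand {K : ℕ} (hK : 0 < K) (a b : ℕ) {c : ℝ}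
    (hc : IsAlgebraic ℚ c) :
    IsSemialgebraicFunOn ℚ {x : Fin 1 → ℝ | ∀ i, x i ∈ Set.Ioo (0:ℝ) 1}
      (fun x => c / ((a - b : ℕ) : ℝ) * (x 0 ^ b - x 0 ^ a) / (1 - x 0 ^ K)) := by
  have hB := isSemialgebraic_box 1
  have hcn : IsAlgebraic ℚ (c / ((a - b : ℕ) : ℝ)) := by
    rw [div_eq_mul_inv]
    exact hc.mul (isAlgebraic_nat (a - b)).inv
  refine (IsSemialgebraicFunOn.mul_holds (isSemialgebraicFunOn_const_of_isAlgebraic hB hcn)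
    (isSemialgebraicFunOn_aeval_div_aeval hB (MvPolynomial.X 0 ^ b - MvPolynomial.X 0 ^ a)
      (1 - MvPolynomial.X 0 ^ K) fun x hx => ?_)).congr fun x _ => ?_
  · have h := (lk_dimOne_bounds hK a b (hx 0).1.le (hx 0).2).1
    simp only [map_sub, map_one, map_pow, MvPolynomial.aeval_X]
    exact h.ne'
  · simp only [Pi.mul_apply, map_sub, map_one, map_pow, MvPolynomial.aeval_X]
    ring

/-- **Absolute convergence of the dimension-one integrand with a real coefficient** (`K ≥ 1`):
`(c/(a−b))·(u^b − u^a)/(1 − u^K)` is integrable on `(0,1)` — it is measurable and bounded there,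
`|(c/(a−b))·(u^b − u^a)/(1 − u^K)| ≤ |c/(a−b)|·(a + b)` (`lk_dimOne_bounds`), and `(0,1) ⊆ [0,1]`
has finite Lebesgue measure. [cite: KontsevichZagier2001, §1.1] -/
theorem lk_integrableOn_dimOneIntegrand {K : ℕ} (hK : 0 < K) (a b : ℕ) (c : ℝ) :
    IntegrableOn
      (fun x : Fin 1 → ℝ => c / ((a - b : ℕ) : ℝ) * (x 0 ^ b - x 0 ^ a) / (1 - x 0 ^ K))
      {x | ∀ i, x i ∈ Set.Ioo (0:ℝ) 1} := by
  have hA : MeasurableSet {x : Fin 1 → ℝ | ∀ i, x i ∈ Set.Ioo (0:ℝ) 1} :=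
    IsSemialgebraic.measurableSet_holds (isSemialgebraic_box 1)
  have hsub : {x : Fin 1 → ℝ | ∀ i, x i ∈ Set.Ioo (0:ℝ) 1} ⊆ Set.Icc 0 1 :=
    fun _ hx => ⟨fun j => (hx j).1.le, fun j => (hx j).2.le⟩
  have hfin : volume {x : Fin 1 → ℝ | ∀ i, x i ∈ Set.Ioo (0:ℝ) 1} ≠ ⊤ :=
    ((measure_mono hsub).trans_lt measure_Icc_lt_top).ne
  refine Measure.integrableOn_of_bounded (M := |c / ((a - b : ℕ) : ℝ)| * ((a + b : ℕ) : ℝ)) hfin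
    (Measurable.aestronglyMeasurable (by fun_prop)) (ae_restrict_of_forall_mem hA fun x hx => ?_)
  have h := lk_dimOne_bounds hK a b (hx 0).1.le (hx 0).2
  rw [Real.norm_eq_abs, abs_div, abs_mul, abs_of_pos h.1, div_le_iff₀ h.1]
  calc |c / ((a - b : ℕ) : ℝ)| * |x 0 ^ b - x 0 ^ a|
      ≤ |c / ((a - b : ℕ) : ℝ)| * (((a + b : ℕ) : ℝ) * (1 - x 0 ^ K)) :=
        mul_le_mul_of_nonneg_left h.2 (abs_nonneg _)
    _ = |c / ((a - b : ℕ) : ℝ)| * ((a + b : ℕ) : ℝ) * (1 - x 0 ^ K) := by ring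

/-- **The dimension-one box of the level-`K` pipeline with an algebraic coefficient exists**
(`K ≥ 1`, all `a b`): `[(0,1), (c/(a−b))·(u^b − u^a)/(1 − u^K)]` is an integral representation
for real algebraic `c` (the constant `c/(a−b)` is algebraic, `c/0 = 0`; the rational factor is a
quotient of `ℚ`-polynomials with denominator `1 − u^K > 0` on `(0,1)`, bounded there).
[cite: KontsevichZagier2001, §1.2 rule (3)] -/
theorem lk_exists_dimOneRep {K : ℕ} (hK : 0 < K) (a b : ℕ) {c : ℝ} (hc : IsAlgebraic ℚ c) :
    ∃ N₁ : IntegralRep 1, N₁.domain = {x | ∀ i, x i ∈ Set.Ioo (0:ℝ) 1} ∧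
      N₁.integrand = fun x => c / ((a - b : ℕ) : ℝ) * (x 0 ^ b - x 0 ^ a) / (1 - x 0 ^ K) :=
  ⟨⟨_, _, isSemialgebraic_box 1, lk_isSemialgebraicFunOn_dimOneIntegrand hK a b hc,
    lk_integrableOn_dimOneIntegrand hK a b c⟩, rfl, rfl⟩

/-! ## The registered sub-goal -/

/-- **Stub K3 (existence of the representations of the level-`K` pipeline; registered sub-goal
`levelK_exists_reps` of stmt-KontsevichZagierPeriods-3869).** For `K ≥ 1` and a real algebraic
coefficient `c`, the level-`K` monomial box `[(0,1)², c·x₀^a x₁^b/(1 − x₀^K x₁^K)]`, the triangle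
`[{0 < z₀ < 1, 0 ≤ z₁ ≤ z₀}, c·z₀^{a−b−1} z₁^b/(1 − z₁^K)]` (`b < a`, the image under the merge
gadget `u = x₀x₁`, rule 2) and the dimension-one box `[(0,1), (c/(a−b))·(u^b − u^a)/(1 − u^K)]`
(the result of integrating out `z₀`, rule 3) all exist as integral representations of the
Kontsevich–Zagier calculus, with literally these domains and integrands.
[cite: KontsevichZagier2001, §1.2] -/
theorem levelK_exists_reps (K : ℕ) (hK : 0 < K) (c : ℝ) (hc : IsAlgebraic ℚ c) :
    (∀ (a b : ℕ), ∃ N : IntegralRep 2, N.domain = {x | ∀ i, x i ∈ Set.Ioo (0:ℝ) 1} ∧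
      N.integrand = fun x => c * (x 0 ^ a * x 1 ^ b) / (1 - x 0 ^ K * x 1 ^ K)) ∧
    (∀ (a b : ℕ), b < a → ∃ R : IntegralRep 2,
      R.domain = KZlog.band {y : Fin 1 → ℝ | 0 < y 0 ∧ y 0 < 1} (fun _ => (0:ℝ)) (fun y => y 0) ∧
      R.integrand = fun z => c * (z 0 ^ (a - b - 1) * z 1 ^ b) / (1 - z 1 ^ K)) ∧
    (∀ (a b : ℕ), ∃ N₁ : IntegralRep 1, N₁.domain = {x | ∀ i, x i ∈ Set.Ioo (0:ℝ) 1} ∧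
      N₁.integrand = fun x => c / ((a - b : ℕ) : ℝ) * (x 0 ^ b - x 0 ^ a) / (1 - x 0 ^ K)) := by
  exact ⟨fun a b => lk_exists_boxRep hK a b hc, fun a b _ => lk_exists_triangleRep hK a b hc,
    fun a b => lk_exists_dimOneRep hK a b hc⟩

end Summit.KontsevichZagierPeriods.HurwitzMicroSectors.NormalFormPrinciple.PiBox.LevelK
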